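import Summits.CriticalPhenomena.Ising3DConformalLimit.Theorems.HyperoctahedralRPExistsScaleCovariantLimitFoldedCurrentClusterSetScaleCovariant
import Summits.CriticalPhenomena.Ising3DConformalLimit.Theorems.HyperoctahedralRPExistsScaleCovariantLimitFoldedCurrentTwoPointImage
import Summits.CriticalPhenomena.Ising3DConformalLimit.Theorems.HyperoctahedralRPExistsScaleCovariantLimitFoldedCurrentPositiveDensity
import Literature.Probability.LatticeModels.PointwiseScalingLimitEtaExists
import HarnessLib

/-!
# If the self-normalised critical two-point function of the 3D Ising model converges pointwise, then `η` EXISTS,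
# `η = 2Δ − 1 ∈ [0, 1/2]`, and the limit is an exactly scale-covariant kernel
# (crux `ExistsScaleCovariantLimit`, item stmt-CriticalPhenomena-1981, line `folded-current-repulsion`; lead c18)

Route `HyperoctahedralRP` / `PositivityBegetsConformality` (sub-problem `CriticalPhenomena/Ising3DConformalLimit`). The re-split
`crux ⟺ PointwiseLimitTwo ∧ FibrewiseTD` (`crux_iff_pointwiseLimitTwo_and_fibrewiseTD`) makes the first factor — item 6153
`PointwiseLimit` AT ORDER TWO: for every pair `x ≠ y` in `ℝ³` the self-normalised critical two-point function
`⟨σ_{⌊x/δ⌋}σ_{⌊y/δ⌋}⟩_{β_c} / ⟨σ₀σ_{⌊1/δ⌋e₀}⟩_{β_c}` converges as `δ → 0⁺` (pointwise, order two only) — a natural milestone. This file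
shows how much that milestone alone already decides:

* `hasIsingExponentEta_of_hasDecayExponent_axis` — an axis decay exponent `log g(m)/log m → −2Δ` of `g(m) = ⟨σ₀σ_{me₀}⟩_{β_c}` is the
  anomalous dimension in all directions, `HasIsingExponentEta 3 (2Δ − 1)` (Messager–Miracle-Solé sphere sandwich; the argument of
  `HasPointwiseScalingLimit.hasIsingExponentEta` with its hypothesis cut down to the axis exponent);
* `half_le_of_log_axis_dyadic`, `le_one_of_log_axis_dyadic` — the dyadic axis exponent lies in `[1/2, 1]` (envelopes
  `c‖x‖⁻² ≤ ⟨σ₀σ_x⟩_{β_c} ≤ C‖x‖⁻¹`, `dyadic_envelopes`);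
* **`twoPointLimit_of_pointwiseLimitTwo`** — if `PointwiseLimit` holds at order two then there are a kernel `G` and an exponent
  `Δ ∈ [1/2, 3/4]` with: `G` is the full-filter pointwise limit at every pair; `G(c x, c y) = c^{-2Δ} G(x, y)` for ALL `c > 0` (exact
  scale covariance); `G > 0` off the diagonal, `G` translation invariant and continuous off the diagonal; and **`η` exists in the
  tree's logarithmic sense, `HasIsingExponentEta 3 (2Δ − 1)`** (so `0 ≤ η ≤ 1/2`, the upper cut being Duminil-Copin–Panis 2025 Thm 1.5,
  `dcp_isingEta_le_half_holds`).
  Mechanism: PointwiseLimitTwo ⟹ item 6150 (`twoPointDoubling_of_pointwiseLimitTwo`) ⟹ compactness (item 5955) ⟹ a cluster point `S₀`;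
  PointwiseLimitTwo ⟹ `stub_twoPointImageTD` (`twoPointImageTD_of_pointwiseLimitTwo`) ⟹ `S₀`'s two-point function is exactly scale covariant
  (`twoPoint_scaleCovariant_of_twoPointImageTD`, no further input) and equals the pointwise limit; the ratio clause
  `ρ_pin(δ/2)/ρ_pin(δ) → 2^{Δ}` is read off at the pair `(0, 2e₀)`, and Lamperti/Cesàro along `δ = 2^{-k}`
  (`tendsto_log_renorm_div_of_ratio_half`) with Messager–Miracle-Solé interpolation (`HasDecayExponent.of_dyadic_of_antitone`) give the exponent.

Compared with the Literature theorem `HasPointwiseScalingLimit.exists_rpow_scale_mem_Icc_threeQuarters` (which assumes the full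
scaling limit: all orders, locally uniform, full filter), the hypothesis here is convergence of the TWO-POINT function only, POINTWISE only.
No definitions; no `sorry`.

References: H. Duminil-Copin, R. Panis, Comm. Math. Phys. 406 (2025), arXiv:2404.05700, Thm 1.5 [DuminilCopinPanis2025LowerBounds];
J. Lamperti, Trans. AMS 104 (1962), Thm 2 [Lamperti1962]; A. Messager, S. Miracle-Solé, J. Stat. Phys. 17 (1977) [MessagerMiracleSoleJSP1977];
H. Duminil-Copin, ICM 2022, §8.4 [DuminilCopinICM2022].
-/

noncomputable section

namespace Summit.CriticalPhenomena.Ising3DConformalLimit.Cruxes.ExistsScaleCovariantLimit.FoldedCurrentRepulsion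

open Filter Set
open scoped Topology
open Literature.Probability.LatticeModels
open Summit.CriticalPhenomena.Ising3DConformalLimit.MoebiusLimitExistsOnlyInteraction
  (rhoPin IsClusterPoint rhoPin_pos smul_mapsTo_nonCoincident_sc)
open Summit.CriticalPhenomena.Ising3DConformalLimit.MoebiusLimitExistsNegative (clusterPoint_two_conv tendsto_div_succ_nhdsGT)
open Summit.CriticalPhenomena.Ising3DConformalLimit.ReflectionTwinExistsContinuousLimit (clusterPoint_nondeg_two)
open Summit.CriticalPhenomena.Ising3DConformalLimit.ExistsScaleCovariantLimitNegative.Dyadic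
  (pz_scale cfg0_mem smul_cfg01 rhoPin_pow_scale pz_two_cfg0_pos)
open Summit.CriticalPhenomena.Ising3DConformalLimit.PinnedClusterPoints (cfg01_mem clusterPoint_cfg01)
open Summit.CriticalPhenomena.Ising3DConformalLimit.Cruxes.ExistsScaleCovariantLimit.TwoHierarchies
  (continuousOn_of_isClusterPoint rhoStar_eq_rhoPin seqLimit_translate)
open Summit.CriticalPhenomena.Ising3DConformalLimit.Cruxes.ExistsScaleCovariantLimit.TwoHierarchies.ItemMaps
  (orbitPrecompact_iff_doubling)
open Summit.CriticalPhenomena.Ising3DConformalLimit.Theses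
open Uniqueness (tight_nhdsGT)

/-! ## §1 From an axis decay exponent to `η` in all directions -/

/-- **An axis decay exponent is the anomalous dimension**: if `log ⟨σ₀σ_{me₀}⟩_{β_c} / log m → −2Δ` on `ℤ³` then
`HasIsingExponentEta 3 (2Δ − 1)`, i.e. `log ⟨σ₀σ_y⟩_{β_c} / log ‖y‖ → −2Δ` along `cofinite` (Messager–Miracle-Solé sphere sandwich
`⟨σ₀σ_{3n e₀}⟩ ≤ ⟨σ₀σ_y⟩ ≤ ⟨σ₀σ_{n e₀}⟩` for `‖y‖_∞ = n`, `criticalTwoPoint_axis_sandwich`).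
[cite: MessagerMiracleSoleJSP1977, main theorem (monotonicity of ⟨σ₀σ_x⟩ under reflections)] -/
theorem hasIsingExponentEta_of_hasDecayExponent_axis {Δ : ℝ}
    (hax : HasDecayExponent (fun m : ℕ => criticalTwoPoint 3 (Pi.single 0 (m : ℤ))) (2 * Δ)) :
    HasIsingExponentEta 3 (2 * Δ - 1) := by
  -- adapted from Literature/Probability/LatticeModels/PointwiseScalingLimitEtaExists.lean (`HasPointwiseScalingLimit.hasIsingExponentEta`)
  have hax3 := hax.comp_three_mul
  unfold HasDecayExponent at hax hax3
  have hn : Tendsto (fun y : Site 3 => Site.supNorm y) cofinite atTop := by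
    have h := Site.tendsto_norm_cofinite_atTop (d := 3)
    simp_rw [Site.norm_eq_supNorm] at h
    exact tendsto_natCast_atTop_iff.1 h
  have hUp := hax.comp hn
  have hLo := hax3.comp hn
  have key : Tendsto (fun y : Site 3 => Real.log (criticalTwoPoint 3 y) / Real.log ‖y‖) cofinite
      (𝓝 (-(2 * Δ))) := by
    refine tendsto_of_tendsto_of_tendsto_of_le_of_le' hLo hUp ?_ ?_
    · filter_upwards [hn.eventually (eventually_gt_atTop 1)] with y hy
      obtain ⟨hlo, -⟩ := criticalTwoPoint_axis_sandwich hy.le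
      have hlog : 0 < Real.log ((Site.supNorm y : ℕ) : ℝ) := Real.log_pos (by exact_mod_cast hy)
      simp only [Function.comp_apply]
      rw [Site.norm_eq_supNorm]
      push_cast at hlo ⊢
      exact div_le_div_of_nonneg_right (Real.log_le_log (criticalTwoPoint_axis_pos _) (by
        simpa only [Nat.cast_mul, Nat.cast_ofNat] using hlo)) hlog.le
    · filter_upwards [hn.eventually (eventually_gt_atTop 1)] with y hy
      obtain ⟨hlo, hup⟩ := criticalTwoPoint_axis_sandwich hy.le
      have hlog : 0 < Real.log ((Site.supNorm y : ℕ) : ℝ) := Real.log_pos (by exact_mod_cast hy)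
      have hpos : 0 < criticalTwoPoint 3 y := (criticalTwoPoint_axis_pos _).trans_le hlo
      simp only [Function.comp_apply]
      rw [Site.norm_eq_supNorm]
      exact div_le_div_of_nonneg_right (Real.log_le_log hpos hup) hlog.le
  unfold HasIsingExponentEta HasSpatialDecayExponent
  convert key using 2
  push_cast
  ring

/-! ## §2 The dyadic axis exponent lies in `[1/2, 1]` -/

/-- If `log g(2^k)/k → −2Δ log 2` for the critical axis two-point function `g` on `ℤ³` then `1/2 ≤ Δ` (upper envelope
`2^k g(2^k) ≤ C`). [cite: DuminilCopin2019, Thm 4.8] -/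
theorem half_le_of_log_axis_dyadic {Δ : ℝ}
    (h : Tendsto (fun k : ℕ => Real.log (criticalTwoPoint 3 (Pi.single 0 ((2 ^ k : ℕ) : ℤ))) / k) atTop
      (𝓝 (-(2 * Δ) * Real.log 2))) : 1/2 ≤ Δ := by
  obtain ⟨c, C, hc, hb⟩ := dyadic_envelopes
  have hl2 : 0 < Real.log 2 := Real.log_pos one_lt_two
  -- upper bound sequence: log g(2^k)/k ≤ (log C - k log 2)/k → -log 2
  have hC : 0 < C := lt_of_lt_of_le (mul_pos (by positivity) (criticalTwoPoint_axis_pos _)) ((hb 0).2)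
  have hup : Tendsto (fun k : ℕ => (Real.log C - k * Real.log 2) / k) atTop (𝓝 (-Real.log 2)) := by
    have h1 : Tendsto (fun k : ℕ => Real.log C / (k:ℝ)) atTop (𝓝 0) := tendsto_const_div_atTop_nhds_zero_nat _
    have h2 : Tendsto (fun k : ℕ => Real.log C / (k:ℝ) - Real.log 2) atTop (𝓝 (0 - Real.log 2)) := h1.sub_const _
    rw [zero_sub] at h2
    refine h2.congr' ?_
    filter_upwards [eventually_gt_atTop 0] with k hk
    have hk' : (k:ℝ) ≠ 0 := by exact_mod_cast hk.ne'
    field_simp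
  have hle : -(2 * Δ) * Real.log 2 ≤ -Real.log 2 := by
    refine le_of_tendsto_of_tendsto h hup ?_
    filter_upwards [eventually_gt_atTop 0] with k hk
    have hk0 : (0:ℝ) < k := by exact_mod_cast hk
    have hg : 0 < criticalTwoPoint 3 (Pi.single 0 ((2 ^ k : ℕ) : ℤ)) := criticalTwoPoint_axis_pos _
    refine div_le_div_of_nonneg_right ?_ hk0.le
    have h2k : (0:ℝ) < (2:ℝ) ^ k := by positivity
    have hgk : criticalTwoPoint 3 (Pi.single 0 ((2 ^ k : ℕ) : ℤ)) ≤ C / (2:ℝ) ^ k := by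
      rw [le_div_iff₀ h2k, mul_comm]
      exact (hb k).2
    calc Real.log (criticalTwoPoint 3 (Pi.single 0 ((2 ^ k : ℕ) : ℤ))) ≤ Real.log (C / (2:ℝ) ^ k) := Real.log_le_log hg hgk
      _ = Real.log C - k * Real.log 2 := by rw [Real.log_div hC.ne' h2k.ne', Real.log_pow]
  nlinarith

/-- If `log g(2^k)/k → −2Δ log 2` for the critical axis two-point function `g` on `ℤ³` then `Δ ≤ 1` (lower envelope
`c ≤ 4^k g(2^k)`). [cite: DuminilCopin2019, Thm 4.8] -/
theorem le_one_of_log_axis_dyadic {Δ : ℝ}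
    (h : Tendsto (fun k : ℕ => Real.log (criticalTwoPoint 3 (Pi.single 0 ((2 ^ k : ℕ) : ℤ))) / k) atTop
      (𝓝 (-(2 * Δ) * Real.log 2))) : Δ ≤ 1 := by
  obtain ⟨c, C, hc, hb⟩ := dyadic_envelopes
  have hl2 : 0 < Real.log 2 := Real.log_pos one_lt_two
  have hl4 : Real.log 4 = 2 * Real.log 2 := by
    rw [show (4:ℝ) = 2 ^ 2 by norm_num, Real.log_pow]; norm_num
  have hlo : Tendsto (fun k : ℕ => (Real.log c - k * Real.log 4) / k) atTop (𝓝 (-Real.log 4)) := by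
    have h1 : Tendsto (fun k : ℕ => Real.log c / (k:ℝ)) atTop (𝓝 0) := tendsto_const_div_atTop_nhds_zero_nat _
    have h2 : Tendsto (fun k : ℕ => Real.log c / (k:ℝ) - Real.log 4) atTop (𝓝 (0 - Real.log 4)) := h1.sub_const _
    rw [zero_sub] at h2
    refine h2.congr' ?_
    filter_upwards [eventually_gt_atTop 0] with k hk
    have hk' : (k:ℝ) ≠ 0 := by exact_mod_cast hk.ne'
    field_simp
  have hle : -Real.log 4 ≤ -(2 * Δ) * Real.log 2 := by
    refine le_of_tendsto_of_tendsto hlo h ?_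
    filter_upwards [eventually_gt_atTop 0] with k hk
    have hk0 : (0:ℝ) < k := by exact_mod_cast hk
    refine div_le_div_of_nonneg_right ?_ hk0.le
    have h4k : (0:ℝ) < (4:ℝ) ^ k := by positivity
    have hgk : c / (4:ℝ) ^ k ≤ criticalTwoPoint 3 (Pi.single 0 ((2 ^ k : ℕ) : ℤ)) := by
      rw [div_le_iff₀ h4k, mul_comm]
      exact (hb k).1
    calc Real.log c - k * Real.log 4 = Real.log (c / (4:ℝ) ^ k) := by rw [Real.log_div hc.ne' h4k.ne', Real.log_pow]
      _ ≤ Real.log (criticalTwoPoint 3 (Pi.single 0 ((2 ^ k : ℕ) : ℤ))) := Real.log_le_log (by positivity) hgk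
  rw [hl4] at hle
  nlinarith

/-! ## §3 The main theorem -/

/-- **IF THE SELF-NORMALISED CRITICAL TWO-POINT FUNCTION OF THE 3D ISING MODEL CONVERGES POINTWISE, THEN `η` EXISTS.** Assume item 6153
`PointwiseLimit` at order two (for every pair `x ≠ y`, `⟨σ_{⌊x/δ⌋}σ_{⌊y/δ⌋}⟩_{β_c}/⟨σ₀σ_{⌊1/δ⌋e₀}⟩_{β_c}` converges as `δ → 0⁺`). Then there are a
kernel `G` and `Δ ∈ [1/2, 3/4]` such that `G` is that limit at every pair, `G(c·) = c^{-2Δ} G` for all `c > 0`, `G > 0` and continuous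
off the diagonal, `G` is translation invariant, and `HasIsingExponentEta 3 (2Δ − 1)`: the critical two-point function decays as
`‖y‖^{-(1+η)}` in the logarithmic sense with `η = 2Δ − 1 ∈ [0, 1/2]`. [cite: DuminilCopinPanis2025LowerBounds, Theorem 1.5] -/
theorem twoPointLimit_of_pointwiseLimitTwo
    (hPL : ∀ x ∈ NonCoincident 3 2, ∃ l : ℝ, Filter.Tendsto (fun δ : ℝ => rescaledCorrelator (criticalCorr 3)
      (fun δ : ℝ => (criticalTwoPoint 3 (Pi.single 0 ⌊δ⁻¹⌋)) ^ (-(1/2:ℝ))) 2 δ x) (nhdsWithin 0 (Set.Ioi 0)) (nhds l)) :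
    ∃ (G : (Fin 2 → EuclideanSpace ℝ (Fin 3)) → ℝ) (Δ : ℝ), Δ ∈ Set.Icc (1/2 : ℝ) (3/4) ∧
      (∀ x ∈ NonCoincident 3 2, Filter.Tendsto (fun δ : ℝ => rescaledCorrelator (criticalCorr 3)
        (fun δ : ℝ => (criticalTwoPoint 3 (Pi.single 0 ⌊δ⁻¹⌋)) ^ (-(1/2:ℝ))) 2 δ x) (nhdsWithin 0 (Set.Ioi 0)) (nhds (G x))) ∧
      (∀ c : ℝ, 0 < c → ∀ x : Fin 2 → EuclideanSpace ℝ (Fin 3), G (fun i => c • x i) = c ^ (-(2:ℝ) * Δ) * G x) ∧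
      (∀ x ∈ NonCoincident 3 2, 0 < G x) ∧
      (∀ (v : EuclideanSpace ℝ (Fin 3)) (x : Fin 2 → EuclideanSpace ℝ (Fin 3)), G (fun i => x i + v) = G x) ∧
      ContinuousOn G (NonCoincident 3 2) ∧
      HasIsingExponentEta 3 (2 * Δ - 1) := by
  classical
  have htd := twoPointImageTD_of_pointwiseLimitTwo hPL
  have hD : MirrorHoelderCompactness.TwoPointDoubling := twoPointDoubling_of_pointwiseLimitTwo hPL
  have hpc : MonotoneRG.OrbitPrecompact := orbitPrecompact_iff_doubling.2 hD
  -- a cluster point along the harmonic meshes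
  have ht : Tendsto (fun m : ℕ => 1 / ((m:ℝ) + 1)) atTop (𝓝[>] (0:ℝ)) := tendsto_div_succ_nhdsGT one_pos
  obtain ⟨φ₀, hφ₀, S₀, hS₀⟩ := tight_nhdsGT hpc ht
  have hu₀ : Tendsto (fun k => 1 / (((φ₀ k : ℕ) : ℝ) + 1)) atTop (𝓝[>] (0:ℝ)) := ht.comp hφ₀.tendsto_atTop
  -- normalise it
  set T : CorrFamily 3 := fun n x => if x ∈ NonCoincident 3 n then S₀ n x else 0 with hT
  have hTn : ∀ n x, x ∉ NonCoincident 3 n → T n x = 0 := fun n x hx => by simp only [hT, if_neg hx]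
  have hTeq : ∀ n, Set.EqOn (T n) (S₀ n) (NonCoincident 3 n) := fun n x hx => by simp only [hT, if_pos hx]
  have hTconv : ∀ n, TendstoLocallyUniformlyOn (fun k => rescaledCorrelator (criticalCorr 3) rhoPin n (1 / (((φ₀ k : ℕ) : ℝ) + 1)))
      (T n) atTop (NonCoincident 3 n) := fun n => (hS₀ n).congr_right (hTeq n).symm
  have hTcp : IsClusterPoint T := ⟨_, hu₀, hTconv⟩
  have hTmem := mem_clusterSet_of_isClusterPoint hTcp hTn
  obtain ⟨Δ, hΔ⟩ := twoPoint_scaleCovariant_of_twoPointImageTD htd T hTmem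
  -- the limit IS `T 2`
  have hlim : ∀ x ∈ NonCoincident 3 2, Filter.Tendsto (fun δ : ℝ => rescaledCorrelator (criticalCorr 3)
      (fun δ : ℝ => (criticalTwoPoint 3 (Pi.single 0 ⌊δ⁻¹⌋)) ^ (-(1/2:ℝ))) 2 δ x) (nhdsWithin 0 (Set.Ioi 0)) (nhds (T 2 x)) := by
    intro x hx
    obtain ⟨l, hl⟩ := hPL x hx
    have hl' := hl
    rw [rhoStar_eq_rhoPin] at hl'
    have e1 : T 2 x = l := tendsto_nhds_unique ((hTconv 2).tendsto_at hx) (hl'.comp hu₀)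
    rw [e1]
    exact hl
  -- values on the axis
  have hT1 : T 2 (![0, EuclideanSpace.single 0 1] : Fin 2 → EuclideanSpace ℝ (Fin 3)) = 1 := clusterPoint_cfg01 hTcp
  have hT2 : T 2 (![0, EuclideanSpace.single 0 2] : Fin 2 → EuclideanSpace ℝ (Fin 3)) = (2:ℝ) ^ (-(2:ℝ) * Δ) := by
    have h := hΔ 2 two_pos (![0, EuclideanSpace.single 0 1] : Fin 2 → EuclideanSpace ℝ (Fin 3))
    rw [smul_cfg01, hT1, mul_one] at h
    exact h
  -- the ratio clause of the pinned renormalisation at `c = 1/2`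
  have hratio : Tendsto (fun δ => rhoPin (1/2 * δ) / rhoPin δ) (𝓝[>] 0) (𝓝 ((1/2:ℝ) ^ (-Δ))) := by
    have h2lim := hlim _ (cfg0_mem (s := (2:ℝ)) two_ne_zero)
    rw [rhoStar_eq_rhoPin, hT2] at h2lim
    have hpos : (2:ℝ) ^ (-(2:ℝ) * Δ) ≠ 0 := (Real.rpow_pos_of_pos two_pos _).ne'
    have h3 := h2lim.rpow_const (p := -(1:ℝ) / 2) (Or.inl hpos)
    have hval : ((2:ℝ) ^ (-(2:ℝ) * Δ)) ^ (-(1:ℝ) / 2) = (1/2:ℝ) ^ (-Δ) := by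
      rw [← Real.rpow_mul two_pos.le, one_div, Real.inv_rpow two_pos.le, Real.rpow_neg two_pos.le, inv_inv]
      congr 1
      ring
    rw [hval] at h3
    refine h3.congr' ?_
    filter_upwards [self_mem_nhdsWithin] with δ (hδ : 0 < δ)
    have h := rhoPin_pow_scale (s := (2:ℝ)) two_pos hδ 1
    rw [pow_one, pow_one] at h
    rw [eq_div_iff (ExistsScaleCovariantLimitNegative.rhoPin_pos' δ).ne', show (1/2:ℝ) * δ = 2⁻¹ * δ by rw [one_div], h]
    norm_num
  -- Lamperti/Cesàro along `δ = 2^{-k}`: `log ρ_pin(2^{-k}) / k → Δ log 2`, i.e. `log g(2^k)/k → -2Δ log 2`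
  have hlog := tendsto_log_renorm_div_of_ratio_half rhoPin_pos hratio
  have hdy : Tendsto (fun k : ℕ => Real.log (criticalTwoPoint 3 (Pi.single 0 ((2 ^ k : ℕ) : ℤ))) / k) atTop
      (𝓝 (-(2 * Δ) * Real.log 2)) := by
    have h2 := hlog.const_mul (-2)
    have hval : (-2:ℝ) * (Δ * Real.log 2) = -(2 * Δ) * Real.log 2 := by ring
    rw [hval] at h2
    refine h2.congr fun k => ?_
    have hfl : ⌊(1:ℝ) / ((1/2:ℝ) ^ k)⌋ = ((2 ^ k : ℕ) : ℤ) := by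
      rw [one_div, one_div, inv_pow, inv_inv, show ((2:ℝ) ^ k) = (((2 ^ k : ℕ) : ℤ) : ℝ) by push_cast; rfl,
        Int.floor_intCast]
    have hg : 0 < criticalTwoPoint 3 (Pi.single 0 ((2 ^ k : ℕ) : ℤ)) := criticalTwoPoint_axis_pos _
    show -2 * (Real.log (rhoPin ((1/2:ℝ) ^ k)) / k) = Real.log (criticalTwoPoint 3 (Pi.single 0 ((2 ^ k : ℕ) : ℤ))) / k
    unfold MoebiusLimitExistsOnlyInteraction.rhoPin
    rw [hfl, Real.log_rpow hg]
    ring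
  have hax : HasDecayExponent (fun m : ℕ => criticalTwoPoint 3 (Pi.single 0 (m : ℤ))) (2 * Δ) :=
    HasDecayExponent.of_dyadic_of_antitone criticalTwoPoint_axis_pos criticalTwoPoint_axis_antitone
      (by simpa only [Nat.cast_pow, Nat.cast_ofNat] using hdy)
  have hη : HasIsingExponentEta 3 (2 * Δ - 1) := hasIsingExponentEta_of_hasDecayExponent_axis hax
  have h34 : Δ ≤ 3/4 := by
    have := dcp_isingEta_le_half_holds (2 * Δ - 1) hη
    linarith
  refine ⟨T 2, Δ, ⟨half_le_of_log_axis_dyadic hdy, h34⟩, hlim, hΔ,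
    clusterPoint_nondeg_two (clusterPoint_two_conv hTcp), ?_, continuousOn_of_isClusterPoint hTcp 2, hη⟩
  -- translation invariance (off the diagonal by `seqLimit_translate`; on it both sides vanish)
  intro v x
  by_cases hx : x ∈ NonCoincident 3 2
  · exact seqLimit_translate hu₀ (hTconv 2) v hx
  · have hx' : (fun i => x i + v) ∉ NonCoincident 3 2 := by
      intro h
      apply hx
      rw [mem_nonCoincident] at h ⊢
      intro i j hij
      exact h (by simp [hij])
    rw [hTn 2 _ hx', hTn 2 x hx]

end Summit.CriticalPhenomena.Ising3DConformalLimit.Cruxes.ExistsScaleCovariantLimit.FoldedCurrentRepulsion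

end
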